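/-
Origin: expansion seat `planner-pub-hodgecm-pv05-0`, handover v2 2026-08-18T03:50:41Z (docstring-only, G-R2-14) (`HOME/pub-hodgecm-pv05/lean/Pv05/Doubling.lean`, md5 71d8b79d, 489 lines);
landed by the gen-5 packager in gate run 20 REPLACES the earlier landed copy of `HodgeCM/PerL34/Doubling.lean` (verbatim).
-/
/-
  HodgeCM/PerL34/Doubling.lean   (WIP module `Pv05.Doubling`; the packager renames on landing)

  LEMMAS.md (carver v1) node **N31b** = PerL v5, Lemma 4.2(b), proof, tex ll. 549–562:
  the DOUBLING SET-UP for the global non-vanishing of `π_i = Θ^{W_i}_{μ_i}(χ'_i)`.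
  Origin: unit pub-hodgecm-pv05 (DAG-node prover #05), session planner-pub-hodgecm-pv05-0.

  WHAT THIS FILE CONTAINS (honest labelling, cell ABSOLUTE RULE):

  * Part A (tex ll. 549–552) — KERNEL-PROVED linear algebra, no hypotheses:
    the doubled hermitian space `W^□ := W ⊕ (−W)` (`hbox`), its polarisation
    `W^□ = W^Δ ⊕ W^∇` by the TOTALLY ISOTROPIC subspaces `W^Δ = {(w,w)}`, `W^∇ = {(w,−w)}`
    (`hbox_Delta`, `hbox_Nabla`, `isCompl_Delta_Nabla`), the pairing `W^Δ × W^∇ → L`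
    (`hbox_diag_adiag`), the isometry group `U(W,h)` as a subgroup of `GL(W)` (`isom`),
    the embedding `ι : U(W) × U(−W) = U(W) × U(W) ↪ H := U(W^□)` (`iota`, `iota_injective`),
    and the fact used by the orbit/unfolding step (N31e): `ι(g₁,g₂)` maps the isotropic line
    `W^Δ` into itself iff `g₁ = g₂` (`iota_mapsTo_Delta_iff`), i.e. `ι(U(W)×U(W)) ∩ P` is the
    diagonal, `P ⊂ H` the stabiliser of `W^Δ`.

  * Part B (tex ll. 552–562) — POSITED DATA + PRINT HYPOTHESES (`DoublingDatum`):
    the Weil representations `ω` (of `U(W_i)(𝔸)` on `𝒮((V₃ ⊗ W_i)(𝔸))`) and `ω^□`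
    (of `H(𝔸)` on `𝒮((V₃ ⊗ W^∇)(𝔸))`), evaluation at `0`, the character `χ_V|_{U(W_i)(𝔸)}`,
    and the intertwiner `δ`, with exactly TWO hypothesis fields, each a published statement
    quoted verbatim in its docstring:
      `equivariant`  = [GQT] §11.3, the two closing displays (restriction of the doubled Weil
                       representation to `G(U_n) × G(U_n)` is `ω ⊗ (ω^∨ · (χ_V ∘ det))`, the twist
                       on the SECOND factor, realised by an isomorphism `δ`) — this is the locus
                       of the R4 FIRST ERROR of the 2026-08-09 reviews (the `χ_V ∘ det` twist was
                       omitted in v4 and restored in v5 ll. 555–559);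
      `ev0_δ`        = [GQT] §11.3 last display `δ(φ₁ ⊗ φ̄₂)(0) = ⟨φ₁, φ₂⟩` (there attributed to
                       [Li92], p. 182, (12): `δ` = partial Fourier transform).
    Nothing in Part B is proved here: the Weil representation itself is not constructed in this
    package (LEMMAS.md §3, defs-needed D4), so N31b is delivered as an HONEST SPLIT (L2):
    Part A kernel-proved + Part B = verbatim PRINT inputs, over which N31c ((eq:basic), tex
    ll. 563–569, node of pv11), N31d (pv15) and N31e (pv09) are stated.

  PRINT SOURCES (checked against the held text where marked ✓):
  [GQT] W. T. Gan, Y. Qiu, S. Takeda, "The regularized Siegel–Weil formula (the second term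
        identity) and the Rallis inner product formula", Invent. Math. 198 (2014) 739–831,
        doi:10.1007/s00222-014-0509-0 = arXiv:1207.4709, §11.3 "Doubling See-Saw" ✓ (held:
        lit key paper:arxiv-1207.4709, chunk p0033 ll. 101–166, read 2026-08-18).
  [Li92] J.-S. Li, "Non-vanishing theorems for the cohomology of certain arithmetic quotients",
        J. reine angew. Math. 428 (1992) 177–217, doi:10.1515/crll.1992.428.177, p. 182 (12)
        — NOT held (acquisition request acq-07570); quoted through [GQT] §11.3, which cites it.
  [HKS] M. Harris, S. Kudla, W. J. Sweet, "Theta dichotomy for unitary groups", J. Amer. Math.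
        Soc. 9 (1996) 941–1004, (1.14)–(1.15) — cited by [GQT] §11.3 ("By [K2] and [HKS]") for
        the restriction formula; [K2] = S. Kudla, "Splitting metaplectic covers of dual reductive
        pairs", Israel J. Math. 87 (1994) 361–401.

  Every declaration below is closed (no placeholders), no new axioms; imports `Mathlib` only.
-/
import Mathlib

set_option autoImplicit false

namespace HodgeCM.PerL34.Doubling

/-! ## Part A — the doubled hermitian space `W^□ = W ⊕ (−W)` (tex ll. 549–552), PROVED

We use Mathlib's convention for sesquilinear forms: `h : W →ₗ⋆[L] W →ₗ[L] L` is
conjugate-linear in the first and linear in the second variable (`L` a commutative ring with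
an involution `star`, e.g. the CM field `L` with complex conjugation, or `L ⊗ 𝔸`). Which
variable carries the conjugation is immaterial for everything below. -/

section DoubledSpace

variable (L : Type*) [CommRing L] [StarRing L]
variable (W : Type*) [AddCommGroup W] [Module L W]

/-- Sesquilinear forms on `W` (Mathlib convention). -/
abbrev Sesq : Type _ := W →ₗ⋆[L] W →ₗ[L] L

variable {L W}

/-- tex l. 549–550: the form of `W^□ := W ⊕ (−W)`, i.e. `h ⊕ (−h)` on `W × W`. -/
def hbox (h : Sesq L W) : Sesq L (W × W) :=
  LinearMap.mk₂'ₛₗ (starRingEnd L) (RingHom.id L)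
    (fun x y => h x.1 y.1 - h x.2 y.2)
    (fun x x' y => by
      simp only [Prod.fst_add, Prod.snd_add, map_add, LinearMap.add_apply]; abel)
    (fun c x y => by
      simp only [Prod.smul_fst, Prod.smul_snd, LinearMap.map_smulₛₗ, LinearMap.smul_apply,
        smul_eq_mul, mul_sub])
    (fun x y y' => by
      simp only [Prod.fst_add, Prod.snd_add, map_add]; abel)
    (fun c x y => by
      simp only [Prod.smul_fst, Prod.smul_snd, map_smul, smul_eq_mul, RingHom.id_apply, mul_sub])

/-- (Ported verbatim from the HodgeCMPerL package; no docstring in the source.) -/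
@[simp] theorem hbox_apply (h : Sesq L W) (x y : W × W) :
    hbox h x y = h x.1 y.1 - h x.2 y.2 := rfl

variable (L W) in
/-- tex l. 550: `w ↦ (w, w)`, whose image is `W^Δ`. -/
def diag : W →ₗ[L] W × W := LinearMap.prod LinearMap.id LinearMap.id

variable (L W) in
/-- tex l. 551: `w ↦ (w, −w)`, whose image is `W^∇`. -/
def adiag : W →ₗ[L] W × W := LinearMap.prod LinearMap.id (-LinearMap.id)

omit [StarRing L] in
/-- (Ported verbatim from the HodgeCMPerL package; no docstring in the source.) -/
@[simp] theorem diag_apply (w : W) : diag L W w = (w, w) := rfl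

omit [StarRing L] in
/-- (Ported verbatim from the HodgeCMPerL package; no docstring in the source.) -/
@[simp] theorem adiag_apply (w : W) : adiag L W w = (w, -w) := rfl

variable (L W) in
/-- tex l. 550: `W^Δ = {(w,w)}`. -/
def Delta : Submodule L (W × W) := LinearMap.range (diag L W)

variable (L W) in
/-- tex l. 551: `W^∇ = {(w,−w)}`. -/
def Nabla : Submodule L (W × W) := LinearMap.range (adiag L W)

omit [StarRing L] in
/-- (Ported verbatim from the HodgeCMPerL package; no docstring in the source.) -/
theorem mem_Delta_iff (x : W × W) : x ∈ Delta L W ↔ x.1 = x.2 := by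
  constructor
  · rintro ⟨w, rfl⟩; rfl
  · intro hx; exact ⟨x.1, Prod.ext rfl hx⟩

omit [StarRing L] in
/-- (Ported verbatim from the HodgeCMPerL package; no docstring in the source.) -/
theorem mem_Nabla_iff (x : W × W) : x ∈ Nabla L W ↔ x.2 = -x.1 := by
  constructor
  · rintro ⟨w, rfl⟩; rfl
  · intro hx; exact ⟨x.1, Prod.ext rfl hx.symm⟩

/-- (Ported verbatim from the HodgeCMPerL package; no docstring in the source.) -/
@[simp] theorem hbox_diag_diag (h : Sesq L W) (w w' : W) :
    hbox h (w, w) (w', w') = 0 := by simp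

/-- (Ported verbatim from the HodgeCMPerL package; no docstring in the source.) -/
@[simp] theorem hbox_adiag_adiag (h : Sesq L W) (w w' : W) :
    hbox h (w, -w) (w', -w') = 0 := by simp [map_neg, LinearMap.neg_apply]

/-- tex l. 550: `W^Δ` is totally isotropic for `h ⊕ (−h)`. -/
theorem hbox_Delta (h : Sesq L W) {x y : W × W} (hx : x ∈ Delta L W) (hy : y ∈ Delta L W) :
    hbox h x y = 0 := by
  obtain ⟨w, rfl⟩ := hx; obtain ⟨w', rfl⟩ := hy; simp

/-- tex l. 551: `W^∇` is totally isotropic for `h ⊕ (−h)`. -/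
theorem hbox_Nabla (h : Sesq L W) {x y : W × W} (hx : x ∈ Nabla L W) (hy : y ∈ Nabla L W) :
    hbox h x y = 0 := by
  obtain ⟨w, rfl⟩ := hx; obtain ⟨w', rfl⟩ := hy; simp [map_neg, LinearMap.neg_apply]

/-- The pairing `W^Δ × W^∇ → L` induced by `h ⊕ (−h)` is `2h`; in particular it is perfect
when `h` is non-degenerate and `2` is invertible, so `W^□ = W^Δ ⊕ W^∇` is a polarisation
(complementary totally isotropic subspaces in duality), tex l. 550. -/
@[simp] theorem hbox_diag_adiag (h : Sesq L W) (w w' : W) :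
    hbox h (w, w) (w', -w') = 2 * h w w' := by
  simp [map_neg, two_mul]

/-- (Ported verbatim from the HodgeCMPerL package; no docstring in the source.) -/
@[simp] theorem hbox_adiag_diag (h : Sesq L W) (w w' : W) :
    hbox h (w, -w) (w', w') = 2 * h w w' := by
  simp [map_neg, LinearMap.neg_apply, two_mul]

omit [StarRing L] in
/-- tex l. 550: `W^□ = W^Δ ⊕ W^∇` (direct sum) as soon as `2` is invertible in `L`. -/
theorem isCompl_Delta_Nabla [Invertible (2 : L)] : IsCompl (Delta L W) (Nabla L W) := by
  have key : ∀ v : W, (⅟(2 : L)) • v + (⅟(2 : L)) • v = v := fun v => by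
    rw [← add_smul, invOf_two_add_invOf_two, one_smul]
  constructor
  · rw [Submodule.disjoint_def]
    intro x hx hx'
    rw [mem_Delta_iff] at hx
    rw [mem_Nabla_iff] at hx'
    have h2 : x.1 + x.1 = 0 := by
      nth_rewrite 2 [hx]; rw [hx']; exact add_neg_cancel x.1
    have hx1 : x.1 = 0 := by
      calc x.1 = (⅟(2 : L)) • x.1 + (⅟(2 : L)) • x.1 := (key x.1).symm
        _ = (⅟(2 : L)) • (x.1 + x.1) := by rw [smul_add]
        _ = 0 := by rw [h2, smul_zero]
    have hx2 : x.2 = 0 := by rw [← hx, hx1]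
    exact Prod.ext hx1 hx2
  · rw [codisjoint_iff, Submodule.eq_top_iff']
    intro z
    rw [Submodule.mem_sup]
    refine ⟨diag L W ((⅟(2 : L)) • (z.1 + z.2)), ⟨_, rfl⟩,
      adiag L W ((⅟(2 : L)) • (z.1 - z.2)), ⟨_, rfl⟩, ?_⟩
    ext
    · simp only [diag_apply, adiag_apply, Prod.fst_add]
      rw [← smul_add, add_add_sub_cancel, smul_add, key]
    · simp only [diag_apply, adiag_apply, Prod.snd_add]
      rw [← smul_neg, ← smul_add, neg_sub, add_comm z.1 z.2, add_add_sub_cancel, smul_add, key]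

/-- The isometry group `U(W, h)` of a sesquilinear form, as a subgroup of `GL(W) = W ≃ₗ[L] W`
(tex l. 552: `U(W_i)`, `U(−W_i) = U(W_i)`, `H := U(W^□)`). -/
def isom (h : Sesq L W) : Subgroup (W ≃ₗ[L] W) where
  carrier := {g | ∀ x y : W, h (g x) (g y) = h x y}
  mul_mem' := by
    intro a b ha hb x y
    simp only [Set.mem_setOf_eq, LinearEquiv.mul_apply] at *
    rw [ha, hb]
  one_mem' := by
    intro x y; rfl
  inv_mem' := by
    intro g hg x y
    simp only [Set.mem_setOf_eq, LinearEquiv.coe_inv] at *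
    have := hg (g.symm x) (g.symm y)
    simpa using this.symm

/-- (Ported verbatim from the HodgeCMPerL package; no docstring in the source.) -/
theorem mem_isom_iff (h : Sesq L W) (g : W ≃ₗ[L] W) :
    g ∈ isom h ↔ ∀ x y : W, h (g x) (g y) = h x y := Iff.rfl

/-- `U(−W) = U(W)`: the isometry groups of `h` and `−h` coincide (tex l. 552). -/
theorem isom_neg (h : Sesq L W) : isom (-h) = isom h := by
  ext g; simp [mem_isom_iff, neg_inj]

/-- tex l. 552: `ι(g₁, g₂) = g₁ ⊕ g₂` as a linear automorphism of `W × W`. -/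
def iotaEquiv (h : Sesq L W) (g : isom h × isom h) : (W × W) ≃ₗ[L] (W × W) :=
  (g.1 : W ≃ₗ[L] W).prodCongr (g.2 : W ≃ₗ[L] W)

/-- (Ported verbatim from the HodgeCMPerL package; no docstring in the source.) -/
@[simp] theorem iotaEquiv_apply (h : Sesq L W) (g : isom h × isom h) (x : W × W) :
    iotaEquiv h g x = ((g.1 : W ≃ₗ[L] W) x.1, (g.2 : W ≃ₗ[L] W) x.2) := rfl

/-- (Ported verbatim from the HodgeCMPerL package; no docstring in the source.) -/
theorem iotaEquiv_mem (h : Sesq L W) (g : isom h × isom h) : iotaEquiv h g ∈ isom (hbox h) := by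
  intro x y
  simp only [iotaEquiv_apply, hbox_apply]
  rw [g.1.2, g.2.2]

/-- tex l. 552: `ι : U(W_i) × U(−W_i) = U(W_i) × U(W_i) ↪ H = U(W^□)`,
`ι(g₁, g₂) = g₁ ⊕ g₂`, as a group homomorphism into the isometry group of `W^□`. -/
def iota (h : Sesq L W) : (isom h × isom h) →* isom (hbox h) where
  toFun g := ⟨iotaEquiv h g, iotaEquiv_mem h g⟩
  map_one' := by ext <;> rfl
  map_mul' := by intro a b; ext <;> rfl

/-- (Ported verbatim from the HodgeCMPerL package; no docstring in the source.) -/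
@[simp] theorem val_iota (h : Sesq L W) (g : isom h × isom h) :
    (iota h g).val = iotaEquiv h g := rfl

/-- (Ported verbatim from the HodgeCMPerL package; no docstring in the source.) -/
theorem iotaEquiv_injective (h : Sesq L W) : Function.Injective (iotaEquiv h) := by
  intro a b hab
  have e1 : ∀ x : W, (a.1 : W ≃ₗ[L] W) x = (b.1 : W ≃ₗ[L] W) x := fun x => by
    have := congrArg (fun e : (W × W) ≃ₗ[L] (W × W) => (e (x, 0)).1) hab
    simpa using this
  have e2 : ∀ x : W, (a.2 : W ≃ₗ[L] W) x = (b.2 : W ≃ₗ[L] W) x := fun x => by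
    have := congrArg (fun e : (W × W) ≃ₗ[L] (W × W) => (e (0, x)).2) hab
    simpa using this
  exact Prod.ext (Subtype.ext (LinearEquiv.ext e1)) (Subtype.ext (LinearEquiv.ext e2))

/-- tex l. 552: `ι` is an embedding. -/
theorem iota_injective (h : Sesq L W) : Function.Injective (iota h) := by
  intro a b hab
  exact iotaEquiv_injective h (congrArg Subtype.val hab)

/-- tex l. 551–552 / used at l. 589 (N31e): `ι(g₁,g₂)` maps the isotropic line `W^Δ` into
itself iff `g₁ = g₂`; i.e. `ι(U(W)×U(W)) ∩ P` is the diagonal, where `P ⊂ H` is the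
stabiliser of `W^Δ`. -/
theorem iota_mapsTo_Delta_iff (h : Sesq L W) (g : isom h × isom h) :
    (∀ x ∈ Delta L W, iotaEquiv h g x ∈ Delta L W) ↔ g.1 = g.2 := by
  constructor
  · intro H
    have : ∀ w : W, (g.1 : W ≃ₗ[L] W) w = (g.2 : W ≃ₗ[L] W) w := fun w => by
      have hw := H (w, w) ⟨w, rfl⟩
      rw [mem_Delta_iff] at hw
      simpa using hw
    exact Subtype.ext (LinearEquiv.ext this)
  · rintro hg x hx
    rw [mem_Delta_iff] at hx ⊢
    simp only [iotaEquiv_apply, hg, hx]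

/-- The diagonal `ι(g,g)` preserves `W^Δ` (it lies in `P`) and `W^∇`. -/
theorem iota_diag_mem_Delta (h : Sesq L W) (g : isom h) {x : W × W} (hx : x ∈ Delta L W) :
    iotaEquiv h (g, g) x ∈ Delta L W :=
  (iota_mapsTo_Delta_iff h (g, g)).2 rfl x hx

/-- (Ported verbatim from the HodgeCMPerL package; no docstring in the source.) -/
theorem iota_diag_mem_Nabla (h : Sesq L W) (g : isom h) {x : W × W} (hx : x ∈ Nabla L W) :
    iotaEquiv h (g, g) x ∈ Nabla L W := by
  rw [mem_Nabla_iff] at hx ⊢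
  simp only [iotaEquiv_apply, hx, map_neg]

end DoubledSpace

/-! ## Part B — the doubling datum at the adelic level (tex ll. 552–562), POSITED

The Weil representations are not constructed in this package (LEMMAS.md §3, D4). We posit
the objects of tex ll. 552–562 as DATA and the two print facts PerL invokes as HYPOTHESIS
FIELDS, quoted verbatim. Convention: PerL's bracket `⟨φ₁, φ₂⟩ = ∫ φ₁ φ̄₂` is linear in the
first variable; Mathlib's `inner` is conjugate-linear in the first variable, so
`pair φ₁ φ₂ := ⟪φ₂, φ₁⟫_ℂ`. The map `δ` of the sources is defined on `φ₁ ⊗ φ̄₂`; we posit it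
as the real-bilinear map `(φ₁, φ₂) ↦ δ(φ₁ ⊗ φ̄₂)`, complex-linear in `φ₁` and conjugate-linear
in `φ₂` (type `S →ₗ[ℂ] S →ₗ⋆[ℂ] Sbox`). -/

noncomputable section Datum

open scoped ComplexConjugate InnerProductSpace

/-- PerL's hermitian bracket `⟨φ₁, φ₂⟩ = ∫ φ₁ φ̄₂` (linear in `φ₁`, tex l. 562, 566), expressed
through Mathlib's inner product (conjugate-linear in the first variable). -/
def pair {S : Type*} [NormedAddCommGroup S] [InnerProductSpace ℂ S] (φ₁ φ₂ : S) : ℂ :=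
  ⟪φ₂, φ₁⟫_ℂ

section pair

variable {S : Type*} [NormedAddCommGroup S] [InnerProductSpace ℂ S]

/-- (Ported verbatim from the HodgeCMPerL package; no docstring in the source.) -/
theorem pair_def (φ₁ φ₂ : S) : pair φ₁ φ₂ = ⟪φ₂, φ₁⟫_ℂ := rfl

/-- (Ported verbatim from the HodgeCMPerL package; no docstring in the source.) -/
@[simp] theorem pair_smul_left (c : ℂ) (φ₁ φ₂ : S) :
    pair (c • φ₁) φ₂ = c * pair φ₁ φ₂ := by
  simp [pair_def]

/-- (Ported verbatim from the HodgeCMPerL package; no docstring in the source.) -/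
@[simp] theorem pair_smul_right (c : ℂ) (φ₁ φ₂ : S) :
    pair φ₁ (c • φ₂) = conj c * pair φ₁ φ₂ := by
  simp [pair_def, mul_comm]

/-- (Ported verbatim from the HodgeCMPerL package; no docstring in the source.) -/
theorem pair_add_left (φ₁ φ₁' φ₂ : S) :
    pair (φ₁ + φ₁') φ₂ = pair φ₁ φ₂ + pair φ₁' φ₂ := by
  simp [pair_def]

/-- (Ported verbatim from the HodgeCMPerL package; no docstring in the source.) -/
theorem pair_add_right (φ₁ φ₂ φ₂' : S) :
    pair φ₁ (φ₂ + φ₂') = pair φ₁ φ₂ + pair φ₁ φ₂' := by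
  simp [pair_def]

/-- (Ported verbatim from the HodgeCMPerL package; no docstring in the source.) -/
theorem pair_conj_symm (φ₁ φ₂ : S) : conj (pair φ₁ φ₂) = pair φ₂ φ₁ := by
  simp [pair_def, inner_conj_symm]

/-- (Ported verbatim from the HodgeCMPerL package; no docstring in the source.) -/
theorem pair_self (φ : S) : pair φ φ = ((‖φ‖ : ℂ)) ^ 2 := by
  rw [pair_def]; exact inner_self_eq_norm_sq_to_K (𝕜 := ℂ) φ

/-- (Ported verbatim from the HodgeCMPerL package; no docstring in the source.) -/
theorem pair_self_ne_zero {φ : S} (hφ : φ ≠ 0) : pair φ φ ≠ 0 := by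
  rw [pair_def]; exact (inner_self_ne_zero (𝕜 := ℂ)).mpr hφ

/-- unitary operators preserve the bracket. -/
@[simp] theorem pair_map_map (u : S ≃ₗᵢ[ℂ] S) (φ₁ φ₂ : S) :
    pair (u φ₁) (u φ₂) = pair φ₁ φ₂ := by
  rw [pair_def, pair_def]; exact u.inner_map_map φ₂ φ₁

end pair


-- port_pkg: scope closed for this part
end Datum
end HodgeCM.PerL34.Doubling
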